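import Summits.BirchSwinnertonDyer.BirchSwinnertonDyer.Theorems.ErratumRoadFiveShimuraKolyvaginOrderBoundInertShiftCebotarev
import Summits.BirchSwinnertonDyer.BirchSwinnertonDyer.Theorems.ClassRecordThreeShimuraKolyvaginOrderBoundAtThreeSurjDeepLevel
import Literature.NumberTheory.EllipticCurves.HeegnerPointsKolyvaginPrimaryOrderCebProofs
import HarnessLib

/-!
# Crux `ShimuraKolyvaginOrderBoundAtThreeSurj` (item stmt-BirchSwinnertonDyer-19899) — McCallum's Prop. 3.1 in KERNEL
# form ONE LEVEL DEEPER: Kolyvagin primes with `Frob(ℓ) = Frob(∞)` on `E[p^{M+k}]` and prescribed kernel of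
# localisation on a subgroup `⟨g₁, g₂, T⟩ ≤ H¹(K, E[p^M])` (the `hCeb` input of the ORDER machine at depth `M + k`)

Cell `bsd-stepL` (run/shared/lean/pub/bsd-stepL/), seat `bsd-stepL-shim3a` (prover g2), HELPER for
`Summit.BirchSwinnertonDyer.BirchSwinnertonDyer.Theses.ClassRecordThree.ShimuraKolyvaginOrderBoundAtThreeSurj`
(`--supports stmt-BirchSwinnertonDyer-19899 --as helper`). Road memo HOME/shim/SHIM3A-G2-ROAD-19899.md §2 (γ₃′),
step (i). Companion of shim-p1 g8's `…InertShiftCebotarev.lean` (p480700), which does the same for McCallum's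
Cor. 3.2 (prescribed local ORDERS of independent eigenclasses — the `cebotarev` field of `HypothesesM`, enough for
the `m₀ = 0` ∕ exponent machine); the ORDER machine (`card_quotient_selmer_le_of_localTerm[_of_conductorNorm]`)
consumes instead the KERNEL form `hCeb` (`HypothesesM.ceb_kernel_of_dictionary[_level]` ⟸
`exists_kolyvaginPrime_gt_pow_kernel`), which this file lifts one level.

## What

* `exists_kolyvaginPrime_gt_pow_kernel_shift` — x11b3's `exists_kolyvaginPrime_gt_pow_kernel` (McCallum 1991 Prop.
  3.1, kernel form) with the Kolyvagin prime produced at DEPTH `M + k` (`FrobEqFrobInfty W K (p ^ (M + k)) ℓ`) while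
  the classes `g₁, g₂, T` stay in `H¹(K, E[p^M])`: for every `b` a Kolyvagin prime `ℓ > b` of level `N`, depth
  `M + k`, with `g ∈ ker(loc_λ) ⟺ g ∈ ⟨T⟩` for every `g ∈ ⟨g₁, g₂, T⟩`. Proof = shim-p1's ι_* trick: apply the
  level-`(M+k)` theorem to `ι_* g₁, ι_* g₂, ι_* T` (`ι_* = torsionH1OfDvd`, injective by `torsionH1OfDvd_pow_injective`
  from `E(K)[p] = 0`, `Aut(K/ℚ)`-equivariant by `conjAct_torsionH1OfDvd`), bound `ℓ` above the primes under the bad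
  places so that `λ` is good, transfer the local kernel by `mem_torsionLocalKer_iff_torsionH1OfDvd_mem` (`Γ_{K_λ}`
  fixes `E[p^{M+k}]`) and the global span by injectivity (`AddMonoidHom.map_closure`, `AddSubgroup.mem_map_iff_mem`);
  the depth-`p` Frobenius clause of `IsKolyvaginPrime` from depth `p^{M+k}` by `frobEqFrobInfty_of_dvd` (p480963).
  NO new Galois-image input.
* `ceb_kernel_of_dictionary_level_shift` — the `hCeb` hypothesis of `HypothesesM.card_quotient_le_of_casselsTate` ∕
  `sum_expo_le_M₀_of_casselsTate` for descent data `S` whose `Kol` contains the DEPTH-`(M+k)` Kolyvagin primes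
  (`IsKolyvaginPrime N W K p ℓ ∧ FrobEqFrobInfty W K (p^(M+k)) ℓ → S.Kol ℓ`) and whose `A ℓ` is "`c_v = 0` at
  `v ∋ ℓ`" — the twin of `HypothesesM.ceb_kernel_of_dictionary_level` for the ORDER machine run at depth `M + k`
  (road memo (γ₃′)(ii)–(iii) are the remaining steps).

## Honest framing

THEOREMS ONLY (no `def`, no named fact, no `sorry`; axioms standard). Inputs: the Čebotarev density theorem and the
Weil pairing as the named facts `chebotarev_artinRep` ∕ `exists_weilPairing` exactly as in x11b3's theorem (both
have `_holds` in the tree). Nothing here runs the ORDER machine at depth `M + k`; item 19899 stays OPEN.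

## References

[cite: McCallumLMS1991, §3 Prop. 3.1 with (2), (3), Cor. 3.2; §4 Lemma 4.6] [cite: GrossLMS1991, §3 (3.1)–(3.3), §9]
[cite: Howard2004Duke, Thm. 3.2.2 (proof)]
presearch: «Čebotarev for Kolyvagin primes at depth M+k controlling classes mod p^M» → [corpus:
book:editornd-l-functions-arithmetic p0279–p0280 McCallum Prop 3.1 ∕ Cor 3.2 (one level)]; Howard Duke §3.2 chooses
primes in 𝓛_{e+d} — printed device; kernel form at two levels not located (corpus + galaxy, SHIM3A-MEMO §6 queries).
Tree: `lean search 'pow_kernel_shift|dictionary_level_shift'` → none.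
-/

noncomputable section

open scoped Classical Pointwise
set_option linter.dupNamespace false
namespace Summit.BirchSwinnertonDyer.BirchSwinnertonDyer.Theorems.ShimuraKolyvaginOrder

open WeierstrassCurve NumberField IsDedekindDomain Field
  Literature.NumberTheory.EllipticCurves Literature.NumberTheory.EllipticCurves.KolyvaginDescent
  Literature.NumberTheory.GaloisRepresentations
  Summit.BirchSwinnertonDyer.Rank1Residual
  Summit.BirchSwinnertonDyer.BirchSwinnertonDyer.Theorems
  Summit.BirchSwinnertonDyer.BirchSwinnertonDyer.Theorems.ShimuraKolyvaginLocalShift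

variable (W : WeierstrassCurve ℚ) {K : Type} [Field K] [NumberField K]

/-- **McCallum 1991, Prop. 3.1 (kernel form) — one Kolyvagin prime of DEPTH `p^{M+k}` above any bound with
prescribed kernel of localisation on `⟨g₁, g₂, T⟩ ≤ H¹(K, E[p^M])`.** Hypotheses as in x11b3's
`exists_kolyvaginPrime_gt_pow_kernel` (at level `M`) plus the extra depth `k`; conclusion: `ℓ > b` with
`IsKolyvaginPrime N W K p ℓ`, `Frob(ℓ) = Frob(∞)` on `K(E[p^{M+k}])`, and `g ∈ ker(loc_λ) ⟺ g ∈ ⟨T⟩` for every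
`g ∈ ⟨g₁, g₂, T⟩` at the place `λ ∋ ℓ`. Proof: the level-`(M+k)` theorem for `ι_* g₁, ι_* g₂, ι_* T`, transferred
back along the injective, `Aut(K/ℚ)`-equivariant change of level `ι_*` (shim-p1's `torsionH1OfDvd_pow_injective`,
`conjAct_torsionH1OfDvd`, `mem_torsionLocalKer_iff_torsionH1OfDvd_mem`). [cite: McCallumLMS1991, §3 Prop. 3.1 with (2), (3)]
[cite: GrossLMS1991, §3 (3.1)–(3.3)] -/
theorem exists_kolyvaginPrime_gt_pow_kernel_shift
    (hC : Literature.NumberTheory.Automorphic.chebotarev_artinRep) {N : ℕ} [NeZero N] [W.IsElliptic]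
    (hK : IsImaginaryQuadratic K) {p : ℕ} (hp : p.Prime) (hp2 : p ≠ 2)
    (hρ : W.HasSurjectiveModNGaloisRep p) (hW : W.exists_weilPairing p) {M : ℕ} (hM : 1 ≤ M) (k : ℕ)
    {c : K ≃ₐ[ℚ] K} (hc : c ≠ 1) (hcc : c * c = 1)
    (Tc : Finset (galH1Torsion (W.baseChange K) ((p ^ M : ℕ) : ℤ)))
    (g₁ g₂ : galH1Torsion (W.baseChange K) ((p ^ M : ℕ) : ℤ)) {ν : ℤ} (hν : ν = 1 ∨ ν = -1)
    (hg₁ : conjAct W c ((p ^ M : ℕ) : ℤ) g₁ = ν • g₁)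
    (hg₂ : conjAct W c ((p ^ M : ℕ) : ℤ) g₂ = (-ν) • g₂)
    (hTc : ∀ t ∈ Tc, ∃ e : ℤ, (e = 1 ∨ e = -1) ∧ conjAct W c ((p ^ M : ℕ) : ℤ) t = e • t)
    (b : ℕ) :
    ∃ ℓ : ℕ, b < ℓ ∧ IsKolyvaginPrime N W K p ℓ ∧ FrobEqFrobInfty W K (p ^ (M + k)) ℓ ∧
      ∀ g ∈ AddSubgroup.closure (insert g₁ (insert g₂ (Tc : Set _))),
        ∀ v : HeightOneSpectrum (𝓞 K), (ℓ : 𝓞 K) ∈ v.asIdeal →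
          (g ∈ (W.baseChange K).torsionLocalKer (v.adicCompletion K) ((p ^ M : ℕ) : ℤ) ↔
            g ∈ AddSubgroup.closure (Tc : Set _)) := by
  classical
  haveI : (W.baseChange K).IsElliptic := inferInstanceAs (W.map (algebraMap ℚ K)).IsElliptic
  have hdvd := natCast_pow_dvd_natCast_pow_add p M k
  set ι := torsionH1OfDvd (W.baseChange K) hdvd with hιdef
  have hιinj : Function.Injective ι := torsionH1OfDvd_pow_injective W hK hp hp2 hρ M k
  -- ### the shifted classes `ι_* g₁, ι_* g₂, ι_* T ∈ H¹(K, E[p^{M+k}])`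
  have hg₁' : conjAct W c ((p ^ (M + k) : ℕ) : ℤ) (ι g₁) = ν • ι g₁ := by
    rw [hιdef, conjAct_torsionH1OfDvd, hg₁, map_zsmul]
  have hg₂' : conjAct W c ((p ^ (M + k) : ℕ) : ℤ) (ι g₂) = (-ν) • ι g₂ := by
    rw [hιdef, conjAct_torsionH1OfDvd, hg₂, map_zsmul]
  have hTc' : ∀ t ∈ Tc.image ι, ∃ e : ℤ, (e = 1 ∨ e = -1) ∧
      conjAct W c ((p ^ (M + k) : ℕ) : ℤ) t = e • t := by
    intro t ht
    obtain ⟨s, hs, rfl⟩ := Finset.mem_image.mp ht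
    obtain ⟨e, he, hes⟩ := hTc s hs
    exact ⟨e, he, by rw [hιdef, conjAct_torsionH1OfDvd, hes, map_zsmul]⟩
  -- ### the bound: above `b` and above the rational primes under the bad places of `E/K`
  have hbad : ((W.baseChange K).badPlaces (𝓞 K)).Finite := (W.baseChange K).finite_badPlaces_holds (𝓞 K)
  set B : ℕ := hbad.toFinset.sup fun w ↦ (Rat.HeightOneSpectrum.primesEquiv (w.under (𝓞 ℚ)) : ℕ)
    with hB
  have hM' : 1 ≤ M + k := le_trans hM (Nat.le_add_right M k)
  obtain ⟨ℓ, hbℓ, hℓP, hℓN, hℓD, hℓp, hprime, hfrob, hloc⟩ :=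
    exists_kolyvaginPrime_gt_pow_kernel (N := N) hC hK hp hp2 hρ hW hM' hc hcc (Tc.image ι) (ι g₁) (ι g₂)
      hν hg₁' hg₂' hTc' (max b B)
  have hb : b < ℓ := lt_of_le_of_lt (le_max_left b B) hbℓ
  have hBℓ : B < ℓ := lt_of_le_of_lt (le_max_right b B) hbℓ
  -- the depth-`p` Frobenius clause of `IsKolyvaginPrime` from depth `p^{M+k}`
  have hKol : IsKolyvaginPrime N W K p ℓ :=
    ⟨hℓP, hℓN, hℓD, hℓp, hprime,
      frobEqFrobInfty_of_dvd W K (dvd_pow_self p (by omega : M + k ≠ 0)) hfrob⟩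
  -- ### good reduction at `λ`
  have hgood : hKol.place ∉ (W.baseChange K).badPlaces (𝓞 K) := by
    intro hmem
    have hle : (Rat.HeightOneSpectrum.primesEquiv (hKol.place.under (𝓞 ℚ)) : ℕ) ≤ B :=
      Finset.le_sup (f := fun w : HeightOneSpectrum (𝓞 K) ↦
        (Rat.HeightOneSpectrum.primesEquiv (w.under (𝓞 ℚ)) : ℕ)) (hbad.mem_toFinset.mpr hmem)
    have hℓeq : (Rat.HeightOneSpectrum.primesEquiv (hKol.place.under (𝓞 ℚ)) : ℕ) = ℓ := by
      rw [(natCast_mem_asIdeal_iff_eq_primesEquiv_symm _ hKol.prime).mp hKol.natCast_mem_under,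
        Equiv.apply_symm_apply]
    omega
  -- ### `Γ_{K_λ}` fixes `E[p^{M+k}]`
  haveI : NeZero (p ^ (M + k)) := ⟨pow_ne_zero _ hp.ne_zero⟩
  have hpv : ((p : ℕ) : 𝓞 K) ∉ hKol.place.asIdeal :=
    not_natCast_mem_of_prime_ne hKol.prime hp hKol.2.2.2.1 hKol.place hKol.mem_place
  have hqv : ((((p ^ (M + k) : ℕ) : ℤ)) : 𝓞 K) ∉ hKol.place.asIdeal := by
    rw [Int.cast_natCast, Nat.cast_pow]
    exact fun h ↦ hpv (hKol.place.isPrime.mem_of_pow_mem (M + k) h)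
  have htriv : ∀ (g : absoluteGaloisGroup (hKol.place.adicCompletion K))
      (Q : geomTorsion (W.baseChange K) ((p ^ (M + k) : ℕ) : ℤ)),
      resGal (K := K) (hKol.place.adicCompletion K) g • Q = Q := fun g Q ↦ by
    rw [resGal_eq_absGaloisRestrict]
    exact absGaloisRestrict_smul_geomTorsion_eq_of_kolyvaginPrime W hK hKol hfrob hgood hqv g Q
  -- ### assemble: transfer the kernel statement back along `ι_*`
  refine ⟨ℓ, hb, hKol, hfrob, fun g hg v hv ↦ ?_⟩
  rw [hKol.mem_iff.mp hv]
  have himg : ι g ∈ AddSubgroup.closure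
      (insert (ι g₁) (insert (ι g₂) ((Tc.image ι : Finset _) : Set _))) := by
    have h := AddSubgroup.mem_map_of_mem ι hg
    rw [AddMonoidHom.map_closure, Set.image_insert_eq, Set.image_insert_eq, ← Finset.coe_image] at h
    exact h
  have key := hloc (ι g) himg hKol.place hKol.mem_place
  have hpd : p ^ M ∣ p ^ (M + k) := pow_dvd_pow p (Nat.le_add_right M k)
  have hpM : p ^ M ≠ 0 := pow_ne_zero M hp.ne_zero
  have hpMk : p ^ (M + k) ≠ 0 := pow_ne_zero _ hp.ne_zero
  have e1 := mem_torsionLocalKer_iff_torsionH1OfDvd_mem (W.baseChange K) (hKol.place.adicCompletion K)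
    hpd hpM hpMk htriv g
  have hcl : AddSubgroup.closure ((Tc.image ι : Finset _) : Set _) =
      (AddSubgroup.closure (Tc : Set _)).map ι := by
    rw [Finset.coe_image, AddMonoidHom.map_closure]
  have e2 : ι g ∈ AddSubgroup.closure ((Tc.image ι : Finset _) : Set _) ↔
      g ∈ AddSubgroup.closure (Tc : Set _) := by
    rw [hcl]
    exact AddSubgroup.mem_map_iff_mem hιinj
  exact e1.trans (key.trans e2)

/-- **`hCeb` for descent data run at DEPTH `M + k`** — twin of x11b3's `HypothesesM.ceb_kernel_of_dictionary_level`
for data `S : HypothesesM (H¹(K, E[n])) Pl`, `n = p^M`, whose involution is `c_*`, whose Kolyvagin primes CONTAIN the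
depth-`(M+k)` Kolyvagin primes (`IsKolyvaginPrime N W K p ℓ ∧ FrobEqFrobInfty W K (p^(M+k)) ℓ`), and whose strict
local conditions `A ℓ` at those primes are "`c_v = 0` at every `v ∋ ℓ`": for eigenclasses `g₁ ∈ V^{ν}`,
`g₂ ∈ V^{-ν}` and a finite set `T` of eigenclasses there is, above every bound, a Kolyvagin prime `ℓ` of `S` with
`⟨g₁, g₂, T⟩ ∩ A ℓ = ⟨T⟩`. [cite: McCallumLMS1991, §3 Prop. 3.1 with (2), (3)] -/
theorem ceb_kernel_of_dictionary_level_shift {Pl : Type*} {N : ℕ} [NeZero N] [W.IsElliptic] {p M n : ℕ}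
    (hn : n = p ^ M) (k : ℕ)
    (S : HypothesesM (galH1Torsion (W.baseChange K) (n : ℤ)) Pl)
    (hC : Literature.NumberTheory.Automorphic.chebotarev_artinRep) (hK : IsImaginaryQuadratic K) (hp : p.Prime)
    (hp2 : p ≠ 2) (hρ : W.HasSurjectiveModNGaloisRep p) (hW : W.exists_weilPairing p)
    (hM : 1 ≤ M) {c : K ≃ₐ[ℚ] K} (hc : c ≠ 1) (hcc : c * c = 1)
    (hτ : ∀ g, S.τ g = conjAct W c (n : ℤ) g)
    (hKol : ∀ ℓ, IsKolyvaginPrime N W K p ℓ → FrobEqFrobInfty W K (p ^ (M + k)) ℓ → S.Kol ℓ)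
    (hA : ∀ ℓ, IsKolyvaginPrime N W K p ℓ → ∀ g, g ∈ S.A ℓ ↔
      ∀ v : HeightOneSpectrum (𝓞 K), (ℓ : 𝓞 K) ∈ v.asIdeal →
        g ∈ (W.baseChange K).torsionLocalKer (v.adicCompletion K) (n : ℤ))
    (T : Finset (galH1Torsion (W.baseChange K) (n : ℤ)))
    (g₁ g₂ : galH1Torsion (W.baseChange K) (n : ℤ)) (ν : ℤ) (hν : ν = 1 ∨ ν = -1)
    (hg₁ : S.τ g₁ = ν • g₁) (hg₂ : S.τ g₂ = (-ν) • g₂)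
    (hT : ∀ t ∈ T, ∃ e : ℤ, (e = 1 ∨ e = -1) ∧ S.τ t = e • t) (b : ℕ) :
    ∃ ℓ, b < ℓ ∧ S.Kol ℓ ∧ ∀ g ∈ AddSubgroup.closure (insert g₁ (insert g₂ (T : Set _))),
      g ∈ S.A ℓ ↔ g ∈ AddSubgroup.closure (T : Set _) := by
  subst hn
  rw [hτ] at hg₁ hg₂
  have hT' : ∀ t ∈ T, ∃ e : ℤ, (e = 1 ∨ e = -1) ∧ conjAct W c ((p ^ M : ℕ) : ℤ) t = e • t :=
    fun t ht ↦ by obtain ⟨e, he, h⟩ := hT t ht; exact ⟨e, he, hτ t ▸ h⟩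
  obtain ⟨ℓ, hbℓ, hKP, hfrob, hloc⟩ := exists_kolyvaginPrime_gt_pow_kernel_shift W (N := N) hC hK hp hp2 hρ
    hW hM k hc hcc T g₁ g₂ hν hg₁ hg₂ hT' b
  refine ⟨ℓ, hbℓ, hKol ℓ hKP hfrob, fun g hg ↦ ?_⟩
  rw [hA ℓ hKP g]
  constructor
  · intro h
    exact (hloc g hg hKP.place hKP.mem_place).mp (h hKP.place hKP.mem_place)
  · intro h v hv
    exact (hloc g hg v hv).mpr h

end Summit.BirchSwinnertonDyer.BirchSwinnertonDyer.Theorems.ShimuraKolyvaginOrder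
end
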